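import Mathlib
import Summits.PneNP.PneNP.Theorems.PstarExpandingModel
import Summits.PneNP.PneNP.Theorems.PstarLinearisationFP

/-!
# Uniform typed `P⋆` instances: counting the distinct AND pairs (first and second moments, exactly)

FRONTIER range-avoidance ladder, ROUND-23 item T23.4 (cell `pnp-ideate`, planner seat p3's seed §5; restricted-model
combinatorics — nothing here bears on `P` versus `NP`).

In the tree's random typed `P⋆` model (`PstarExpandingModel.Outcome N m`: every output draws an ordered XOR pair and an
ordered AND pair of distinct variables; `inst ω : LocalMap 4 (N + N) m`) we count the number `D(ω)` of DISTINCT AND pairs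
(`dval ω = numAndPairs (inst ω)`), the quantity deciding membership in the linearisable class
`PstarLinearisation.LinearisablePstar` (`n + numAndPairs < m`, solved in FP by `pstarLinearisable_localAvoidLinearFP`).
This file is the exact bookkeeping of the first two moments of `D` as plain sums over the finite outcome space: bins =
off-diagonal unordered pairs (`card_bins = C(N,2)`), each with a 2-element fibre among ordered pairs (`card_pfib`), so the
miss cylinders are product sets, `#Miss S = (K₀ · #pmiss S)^m` with `#pmiss {b} = K₀ − 2`, `#pmiss {b,b'} = K₀ − 4`
(`K₀ = #DPair N = N² − N`); `D(ω) = Σ_{b ∈ bins} [b ∈ img ω]` gives `S₁ = Σ_ω D = Σ_b #Hit b`, `S₂ = Σ_ω D² =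
Σ_{b,b'} #(Hit b ∩ Hit b')` (`sum_dval`, `sum_dval_sq`), the hit counts come from the miss cylinders by inclusion–exclusion,
and the NEGATIVE CORRELATION inequality `M₂·W ≤ M₁²` (`missTwo_mul_le`) yields `W·Var(D) ≤ S₁` (`variance_le`).
The estimate (Chebyshev as counting, the birthday mean) and the theorem are in `PstarUniformLinearisable`.
-/

set_option linter.dupNamespace false -- `Summit.PneNP.PneNP.…`: summit = sub-problem name (D-0017 single-conjunct layout)

open Finset Literature.Computability.Complexity
open Summit.PneNP.PneNP.Theorems.PstarExpandingModel (DPair Outcome inst isPure_inst)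
open Summit.PneNP.PneNP.Theorems.PstarLinearisation (andEdge numAndPairs LinearisablePstar)

namespace Summit.PneNP.PneNP.Theorems.PstarUniformRepeats

variable {N m : ℕ}

/-! ## AND keys and the number of distinct AND pairs -/

/-- The key of an ordered pair of distinct points: the underlying unordered pair. -/
def pkey (p : DPair N) : Sym2 (Fin N) := s(p.1.1, p.1.2)

/-- The AND key of one output of an outcome (its AND pair, unordered). -/
def akey (q : DPair N × DPair N) : Sym2 (Fin N) := pkey q.2

/-- The set of distinct AND keys of an outcome. -/
def img (ω : Outcome N m) : Finset (Sym2 (Fin N)) := univ.image fun j => akey (ω j)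

/-- `D(ω)`: the number of distinct AND keys of an outcome. -/
def dval (ω : Outcome N m) : ℕ := (img ω).card

/-- `numAndPairs (inst ω) = D(ω)`. -/
theorem numAndPairs_inst (ω : Outcome N m) : numAndPairs (inst ω) = dval ω := by
  unfold PstarLinearisation.numAndPairs dval img
  have h : (univ.image (andEdge (inst ω))) =
      (univ.image fun j => akey (ω j)).image (Sym2.map (Fin.natAdd N)) := by
    rw [Finset.image_image]; rfl
  rw [h, Finset.card_image_of_injective _ (Sym2.map.injective (Fin.natAdd_injective _ _))]

/-- An outcome's instance is NOT linearisable iff `m ≤ 2N + D(ω)`. -/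
theorem not_linearisable_iff (ω : Outcome N m) : ¬LinearisablePstar (inst ω) ↔ m ≤ (N + N) + dval ω := by
  unfold PstarLinearisation.LinearisablePstar
  rw [numAndPairs_inst]
  exact ⟨fun h => by by_contra h'; exact h ⟨isPure_inst ω, by omega⟩, fun h ⟨_, h'⟩ => by omega⟩

/-- `D(ω) ≤ m`. -/
theorem dval_le (ω : Outcome N m) : dval ω ≤ m := by
  unfold dval img
  exact card_image_le.trans (by rw [card_univ, Fintype.card_fin])

/-! ## Bins: off-diagonal unordered pairs -/

/-- The bins: unordered pairs of DISTINCT points. -/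
def bins (N : ℕ) : Finset (Sym2 (Fin N)) := univ.filter fun b => ¬b.IsDiag

/-- `#bins = C(N, 2)`. -/
theorem card_bins (N : ℕ) : (bins N).card = N.choose 2 := by
  rw [bins, ← Fintype.card_subtype, Sym2.card_subtype_not_diag, Fintype.card_fin]

/-- Keys of ordered distinct pairs are off-diagonal. -/
theorem pkey_not_isDiag (p : DPair N) : ¬(pkey p).IsDiag := by
  rw [pkey, Sym2.mk_isDiag_iff]; exact p.2

/-- AND keys are bins. -/
theorem akey_mem_bins (q : DPair N × DPair N) : akey q ∈ bins N := by
  simp only [bins, mem_filter, mem_univ, true_and]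
  exact pkey_not_isDiag q.2

/-- The key set of an outcome consists of bins. -/
theorem img_subset_bins (ω : Outcome N m) : img ω ⊆ bins N := by
  intro b hb
  obtain ⟨j, -, rfl⟩ := mem_image.1 hb
  exact akey_mem_bins _

/-- `D(ω) ≤ C(N, 2)`. -/
theorem dval_le_choose (ω : Outcome N m) : dval ω ≤ N.choose 2 :=
  (card_le_card (img_subset_bins ω)).trans (card_bins N).le

/-- `D(ω)` as a sum of indicators over the bins. -/
theorem dval_eq_sum (ω : Outcome N m) : dval ω = ∑ b ∈ bins N, if b ∈ img ω then 1 else 0 := by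
  rw [← Finset.card_filter, Finset.filter_mem_eq_inter, Finset.inter_eq_right.2 (img_subset_bins ω)]
  rfl

/-! ## Fibres of the key map and the miss counts among ordered pairs -/

/-- The ordered pairs with a given key. -/
def pfib (b : Sym2 (Fin N)) : Finset (DPair N) := univ.filter fun p => pkey p = b

/-- Every bin has exactly two ordered pairs above it. -/
theorem card_pfib {b : Sym2 (Fin N)} (hb : ¬b.IsDiag) : (pfib b).card = 2 := by
  revert hb
  refine Sym2.ind (fun u v => ?_) b
  intro huv
  rw [Sym2.mk_isDiag_iff] at huv
  have h : pfib s(u, v) = {⟨(u, v), huv⟩, ⟨(v, u), Ne.symm huv⟩} := by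
    ext p
    simp only [pfib, mem_filter, mem_univ, true_and, mem_insert, mem_singleton, pkey, Sym2.eq_iff]
    constructor
    · rintro (⟨h1, h2⟩ | ⟨h1, h2⟩)
      · exact Or.inl (Subtype.ext (Prod.ext h1 h2))
      · exact Or.inr (Subtype.ext (Prod.ext h1 h2))
    · rintro (rfl | rfl)
      · exact Or.inl ⟨rfl, rfl⟩
      · exact Or.inr ⟨rfl, rfl⟩
  rw [h, card_pair]
  intro h'
  exact huv (congrArg (fun p : DPair N => p.1.1) h')

/-- The ordered pairs whose key avoids `S`. -/
def pmiss (S : Finset (Sym2 (Fin N))) : Finset (DPair N) := univ.filter fun p => pkey p ∉ S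

/-- `#pmiss {b} = K₀ − 2`. -/
theorem card_pmiss_singleton {b : Sym2 (Fin N)} (hb : ¬b.IsDiag) :
    (pmiss ({b} : Finset (Sym2 (Fin N)))).card + 2 = Fintype.card (DPair N) := by
  have h := Finset.card_filter_add_card_filter_not (s := (univ : Finset (DPair N))) (fun p => pkey p = b)
  have e : (univ.filter fun p : DPair N => ¬pkey p = b) = pmiss {b} := by
    unfold pmiss
    exact filter_congr (fun p _ => by simp)
  rw [e, card_univ] at h
  have h2 := card_pfib hb
  unfold pfib at h2
  omega

/-- `#pmiss {b, b'} = K₀ − 4` for distinct bins. -/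
theorem card_pmiss_pair {b b' : Sym2 (Fin N)} (hb : ¬b.IsDiag) (hb' : ¬b'.IsDiag) (hne : b ≠ b') :
    (pmiss ({b, b'} : Finset (Sym2 (Fin N)))).card + 4 = Fintype.card (DPair N) := by
  have h := Finset.card_filter_add_card_filter_not (s := (univ : Finset (DPair N)))
    (fun p => pkey p = b ∨ pkey p = b')
  have e1 : (univ.filter fun p : DPair N => pkey p = b ∨ pkey p = b') = pfib b ∪ pfib b' := by
    unfold pfib; rw [filter_or]
  have hdisj : Disjoint (pfib b) (pfib b') := by
    rw [disjoint_left]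
    intro p h1 h2
    simp only [pfib, mem_filter, mem_univ, true_and] at h1 h2
    exact hne (h1.symm.trans h2)
  have e2 : (univ.filter fun p : DPair N => ¬(pkey p = b ∨ pkey p = b')) = pmiss {b, b'} := by
    unfold pmiss
    exact filter_congr (fun p _ => by simp [not_or])
  rw [e1, e2, card_union_of_disjoint hdisj, card_pfib hb, card_pfib hb', card_univ] at h
  omega

/-- `K₀ = #DPair N = N² − N`. -/
theorem card_DPair (N : ℕ) : Fintype.card (DPair N) = N * N - N := by
  unfold PstarExpandingModel.DPair
  rw [Fintype.card_subtype_compl, Fintype.card_prod, Fintype.card_fin]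
  congr 1
  rw [Fintype.card_subtype]
  have h : (univ.filter fun p : Fin N × Fin N => p.1 = p.2) = (univ : Finset (Fin N)).image fun a => (a, a) := by
    ext p
    simp only [Finset.mem_filter, Finset.mem_univ, true_and, Finset.mem_image]
    exact ⟨fun h => ⟨p.1, Prod.ext rfl h⟩, by rintro ⟨a, rfl⟩; rfl⟩
  rw [h, Finset.card_image_of_injective _ (fun a b h => (Prod.ext_iff.1 h).1), Finset.card_univ, Fintype.card_fin]

/-! ## Miss cylinders and hit sets of outcomes -/

/-- Outcomes all of whose AND keys avoid `S` (a product cylinder). -/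
def Miss (m : ℕ) (S : Finset (Sym2 (Fin N))) : Finset (Outcome N m) := univ.filter fun ω => ∀ j, akey (ω j) ∉ S

/-- Outcomes one of whose AND keys is `b`. -/
def Hit (m : ℕ) (b : Sym2 (Fin N)) : Finset (Outcome N m) := univ.filter fun ω => b ∈ img ω

/-- Membership in the key set. -/
theorem mem_img {ω : Outcome N m} {b : Sym2 (Fin N)} : b ∈ img ω ↔ ∃ j, akey (ω j) = b := by
  simp [img]

/-- The miss cylinder is a product set. -/
theorem Miss_eq_piFinset (S : Finset (Sym2 (Fin N))) :
    Miss m S = Fintype.piFinset fun _ : Fin m => (univ.filter fun q : DPair N × DPair N => akey q ∉ S) := by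
  ext ω
  simp [Miss, Fintype.mem_piFinset]

/-- One-output miss count: the XOR pair is free. -/
theorem card_qmiss (S : Finset (Sym2 (Fin N))) :
    (univ.filter fun q : DPair N × DPair N => akey q ∉ S).card = Fintype.card (DPair N) * (pmiss S).card := by
  have h : (univ.filter fun q : DPair N × DPair N => akey q ∉ S) = (univ : Finset (DPair N)) ×ˢ pmiss S := by
    ext q
    simp [pmiss, akey]
  rw [h, card_product, card_univ]

/-- `#Miss S = (K₀ · #pmiss S)^m`. -/
theorem card_Miss (S : Finset (Sym2 (Fin N))) :
    (Miss m S).card = (Fintype.card (DPair N) * (pmiss S).card) ^ m := by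
  rw [Miss_eq_piFinset, Fintype.card_piFinset, prod_const, card_univ, Fintype.card_fin, card_qmiss]

/-- Hitting `b` is the complement of missing `{b}`. -/
theorem Hit_eq_compl (b : Sym2 (Fin N)) : Hit m b = (Miss m ({b} : Finset (Sym2 (Fin N))))ᶜ := by
  ext ω
  simp [Hit, Miss, mem_img]

/-- `#Hit b + #Miss {b} = W`. -/
theorem card_Hit_add (b : Sym2 (Fin N)) :
    (Hit m b).card + (Miss m ({b} : Finset (Sym2 (Fin N)))).card = Fintype.card (Outcome N m) := by
  rw [Hit_eq_compl, Finset.card_compl]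
  have := (Miss m ({b} : Finset (Sym2 (Fin N)))).card_le_univ
  omega

/-- Missing `{b}` and `{b'}` is missing `{b, b'}`. -/
theorem Miss_inter (b b' : Sym2 (Fin N)) :
    Miss m ({b} : Finset (Sym2 (Fin N))) ∩ Miss m {b'} = Miss m {b, b'} := by
  ext ω
  simp only [Miss, mem_inter, mem_filter, mem_univ, true_and, mem_singleton, mem_insert, not_or]
  exact ⟨fun h j => ⟨h.1 j, h.2 j⟩, fun h => ⟨fun j => (h j).1, fun j => (h j).2⟩⟩

/-- Hitting both is the complement of missing one of them. -/
theorem Hit_inter_Hit (b b' : Sym2 (Fin N)) :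
    Hit m b ∩ Hit m b' = (Miss m ({b} : Finset (Sym2 (Fin N))) ∪ Miss m {b'})ᶜ := by
  rw [Hit_eq_compl, Hit_eq_compl, Finset.compl_union]

/-- Inclusion–exclusion: `#(Hit b ∩ Hit b') + #Miss{b} + #Miss{b'} = W + #Miss{b,b'}`. -/
theorem card_HitHit_add (b b' : Sym2 (Fin N)) :
    (Hit m b ∩ Hit m b').card + (Miss m ({b} : Finset (Sym2 (Fin N)))).card + (Miss m ({b'} : Finset _)).card =
      Fintype.card (Outcome N m) + (Miss m ({b, b'} : Finset (Sym2 (Fin N)))).card := by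
  rw [Hit_inter_Hit, Finset.card_compl, ← Miss_inter]
  have h1 := (Miss m ({b} : Finset (Sym2 (Fin N))) ∪ Miss m {b'}).card_le_univ
  have h2 := Finset.card_union_add_card_inter (Miss m ({b} : Finset (Sym2 (Fin N)))) (Miss m {b'})
  omega

/-! ## The first two moments as sums over bins -/

/-- `S₁ = Σ_ω D(ω) = Σ_{b ∈ bins} #Hit b`. -/
theorem sum_dval : ∑ ω : Outcome N m, dval ω = ∑ b ∈ bins N, (Hit m b).card := by
  simp_rw [dval_eq_sum]
  rw [Finset.sum_comm]
  refine sum_congr rfl fun b _ => ?_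
  rw [Hit, card_filter]

/-- `S₂ = Σ_ω D(ω)² = Σ_{b, b' ∈ bins} #(Hit b ∩ Hit b')`. -/
theorem sum_dval_sq :
    ∑ ω : Outcome N m, dval ω ^ 2 = ∑ b ∈ bins N, ∑ b' ∈ bins N, (Hit m b ∩ Hit m b').card := by
  have h : ∀ ω : Outcome N m, dval ω ^ 2 =
      ∑ b ∈ bins N, ∑ b' ∈ bins N, if b ∈ img ω ∧ b' ∈ img ω then 1 else 0 := by
    intro ω
    rw [sq, dval_eq_sum, sum_mul_sum]
    refine sum_congr rfl fun b _ => sum_congr rfl fun b' _ => ?_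
    rw [ite_zero_mul_ite_zero, one_mul]
  simp_rw [h]
  rw [Finset.sum_comm]
  refine sum_congr rfl fun b _ => ?_
  rw [Finset.sum_comm]
  refine sum_congr rfl fun b' _ => ?_
  rw [Hit, Hit, ← filter_and, card_filter]

/-! ## Closed forms -/

/-- `K₀`: the number of ordered pairs of distinct points. -/
def K0 (N : ℕ) : ℕ := Fintype.card (DPair N)

/-- `M₁ = (K₀(K₀−2))^m`: the outcomes missing one given bin. -/
def missOne (N m : ℕ) : ℕ := (K0 N * (K0 N - 2)) ^ m

/-- `M₂ = (K₀(K₀−4))^m`: the outcomes missing two given bins. -/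
def missTwo (N m : ℕ) : ℕ := (K0 N * (K0 N - 4)) ^ m

/-- `#Miss {b} = M₁` for a bin `b`. -/
theorem card_Miss_singleton {b : Sym2 (Fin N)} (hb : b ∈ bins N) :
    (Miss m ({b} : Finset (Sym2 (Fin N)))).card = missOne N m := by
  simp only [bins, mem_filter, mem_univ, true_and] at hb
  rw [card_Miss, missOne, K0]
  have h := card_pmiss_singleton hb
  congr 2
  omega

/-- `#Miss {b, b'} = M₂` for distinct bins. -/
theorem card_Miss_pair {b b' : Sym2 (Fin N)} (hb : b ∈ bins N) (hb' : b' ∈ bins N) (hne : b ≠ b') :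
    (Miss m ({b, b'} : Finset (Sym2 (Fin N)))).card = missTwo N m := by
  simp only [bins, mem_filter, mem_univ, true_and] at hb hb'
  rw [card_Miss, missTwo, K0]
  have h := card_pmiss_pair hb hb' hne
  congr 2
  omega

/-- `W = #Outcome N m = (K₀·K₀)^m`. -/
theorem card_Outcome_eq (N m : ℕ) : Fintype.card (Outcome N m) = (K0 N * K0 N) ^ m := by
  rw [Fintype.card_fun, Fintype.card_fin, Fintype.card_prod, K0]

/-- `M₁ ≤ W`. -/
theorem missOne_le (N m : ℕ) : missOne N m ≤ Fintype.card (Outcome N m) := by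
  rw [card_Outcome_eq, missOne]
  exact Nat.pow_le_pow_left (Nat.mul_le_mul_left _ (Nat.sub_le _ _)) _

/-- **Negative correlation of the miss events**: `M₂ · W ≤ M₁²` (from `K₀(K₀−4) ≤ (K₀−2)²`). -/
theorem missTwo_mul_le (N m : ℕ) : missTwo N m * Fintype.card (Outcome N m) ≤ missOne N m ^ 2 := by
  rw [card_Outcome_eq, missTwo, missOne, ← mul_pow, ← pow_mul, mul_comm m 2, pow_mul]
  refine Nat.pow_le_pow_left ?_ _
  have h : K0 N * (K0 N - 4) ≤ (K0 N - 2) * (K0 N - 2) := by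
    rcases le_or_gt 4 (K0 N) with h4 | h4
    · zify [h4, (by omega : 2 ≤ K0 N)]
      nlinarith
    · rw [Nat.sub_eq_zero_of_le h4.le, Nat.mul_zero]; exact Nat.zero_le _
  calc K0 N * (K0 N - 4) * (K0 N * K0 N) = (K0 N * (K0 N - 4)) * (K0 N * K0 N) := rfl
    _ ≤ ((K0 N - 2) * (K0 N - 2)) * (K0 N * K0 N) := Nat.mul_le_mul_right _ h
    _ = (K0 N * (K0 N - 2)) ^ 2 := by ring

/-- `#Hit b = W − M₁` on bins (real form). -/
theorem card_Hit_real {b : Sym2 (Fin N)} (hb : b ∈ bins N) :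
    ((Hit m b).card : ℝ) = (Fintype.card (Outcome N m) : ℝ) - missOne N m := by
  have h := card_Hit_add (m := m) b
  rw [card_Miss_singleton hb] at h
  have h' : ((Hit m b).card : ℝ) + missOne N m = Fintype.card (Outcome N m) := by exact_mod_cast h
  linarith

/-- `#(Hit b ∩ Hit b') = W − 2M₁ + M₂` for distinct bins (real form). -/
theorem card_HitHit_real {b b' : Sym2 (Fin N)} (hb : b ∈ bins N) (hb' : b' ∈ bins N) (hne : b ≠ b') :
    ((Hit m b ∩ Hit m b').card : ℝ) = (Fintype.card (Outcome N m) : ℝ) - 2 * missOne N m + missTwo N m := by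
  have h := card_HitHit_add (m := m) b b'
  rw [card_Miss_singleton hb, card_Miss_singleton hb', card_Miss_pair hb hb' hne] at h
  have h' : ((Hit m b ∩ Hit m b').card : ℝ) + missOne N m + missOne N m =
      Fintype.card (Outcome N m) + missTwo N m := by exact_mod_cast h
  linarith

/-- **First moment, closed form**: `S₁ = C(N,2) · (W − M₁)`. -/
theorem sum_dval_real :
    ((∑ ω : Outcome N m, dval ω : ℕ) : ℝ) = (N.choose 2 : ℝ) * ((Fintype.card (Outcome N m) : ℝ) - missOne N m) := by
  rw [sum_dval, Nat.cast_sum, sum_congr rfl fun b hb => card_Hit_real (m := m) hb, sum_const, card_bins,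
    nsmul_eq_mul]

/-- **Second moment, closed form**: `S₂ = C(N,2)·[(W − M₁) + (C(N,2) − 1)(W − 2M₁ + M₂)]`. -/
theorem sum_dval_sq_real :
    ((∑ ω : Outcome N m, dval ω ^ 2 : ℕ) : ℝ) = (N.choose 2 : ℝ) *
      (((Fintype.card (Outcome N m) : ℝ) - missOne N m) +
        ((N.choose 2 : ℝ) - 1) * ((Fintype.card (Outcome N m) : ℝ) - 2 * missOne N m + missTwo N m)) := by
  rw [sum_dval_sq, Nat.cast_sum]
  have h : ∀ b ∈ bins N, ((∑ b' ∈ bins N, (Hit m b ∩ Hit m b').card : ℕ) : ℝ) =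
      ((Fintype.card (Outcome N m) : ℝ) - missOne N m) +
        ((N.choose 2 : ℝ) - 1) * ((Fintype.card (Outcome N m) : ℝ) - 2 * missOne N m + missTwo N m) := by
    intro b hb
    rw [← add_sum_erase _ _ hb, inter_self, Nat.cast_add, card_Hit_real hb, Nat.cast_sum]
    have h2 : ∀ b' ∈ (bins N).erase b, ((Hit m b ∩ Hit m b').card : ℝ) =
        (Fintype.card (Outcome N m) : ℝ) - 2 * missOne N m + missTwo N m := by
      intro b' hb'
      exact card_HitHit_real hb (mem_of_mem_erase hb') (ne_of_mem_erase hb').symm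
    rw [sum_congr rfl h2, sum_const, card_erase_of_mem hb, card_bins, nsmul_eq_mul]
    have h1 : 1 ≤ N.choose 2 := by
      rw [← card_bins]; exact card_pos.2 ⟨b, hb⟩
    rw [Nat.cast_sub h1, Nat.cast_one]
  rw [sum_congr rfl h, sum_const, card_bins, nsmul_eq_mul]

/-- Two distinct bins exist once `N ≥ 3`. -/
theorem exists_two_bins (hN : 3 ≤ N) : ∃ b ∈ bins N, ∃ b' ∈ bins N, b ≠ b' := by
  rw [← Finset.one_lt_card, card_bins]
  have h := Nat.choose_le_choose 2 hN
  have h3 : Nat.choose 3 2 = 3 := by decide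
  omega

/-- `W > 0` once `N ≥ 2`. -/
theorem card_Outcome_pos (hN : 2 ≤ N) : 0 < Fintype.card (Outcome N m) := by
  rw [card_Outcome_eq, K0, card_DPair]
  have h : 2 ≤ N * N - N := by
    have : N + 2 ≤ N * N := by nlinarith
    omega
  positivity

/-- **`W · Var(D) ≤ S₁`**: `S₂ − S₁²/W ≤ S₁` (negative correlation of the miss events), for `N ≥ 3`. -/
theorem variance_le (hN : 3 ≤ N) :
    ((∑ ω : Outcome N m, dval ω ^ 2 : ℕ) : ℝ) -
        ((∑ ω : Outcome N m, dval ω : ℕ) : ℝ) ^ 2 / (Fintype.card (Outcome N m) : ℝ) ≤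
      ((∑ ω : Outcome N m, dval ω : ℕ) : ℝ) := by
  obtain ⟨b, hb, b', hb', hne⟩ := exists_two_bins hN
  have hH := card_HitHit_real (m := m) hb hb' hne
  rw [sum_dval_sq_real, sum_dval_real]
  set W : ℝ := (Fintype.card (Outcome N m) : ℝ) with hWdef
  set K : ℝ := (N.choose 2 : ℝ) with hKdef
  set M1 : ℝ := (missOne N m : ℝ) with hM1def
  set M2 : ℝ := (missTwo N m : ℝ) with hM2def
  have hWpos : (0 : ℝ) < W := by rw [hWdef]; exact_mod_cast card_Outcome_pos (m := m) (by omega : 2 ≤ N)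
  have hK : (0 : ℝ) ≤ K := Nat.cast_nonneg _
  have hneg : M2 * W ≤ M1 ^ 2 := by
    have h' : ((missTwo N m * Fintype.card (Outcome N m) : ℕ) : ℝ) ≤ ((missOne N m ^ 2 : ℕ) : ℝ) := by
      exact_mod_cast missTwo_mul_le N m
    push_cast at h'
    exact h'
  have hH0 : (0 : ℝ) ≤ W - 2 * M1 + M2 := by rw [← hH]; exact Nat.cast_nonneg _
  -- clear the denominator: `K(K−1)·H ≤ (K(W−M₁))²/W`
  have hmain : K * (K - 1) * (W - 2 * M1 + M2) ≤ (K * (W - M1)) ^ 2 / W := by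
    rw [le_div_iff₀ hWpos]
    have key : (K * (W - M1)) ^ 2 - K * (K - 1) * (W - 2 * M1 + M2) * W =
        K ^ 2 * (M1 ^ 2 - M2 * W) + K * (W - 2 * M1 + M2) * W := by ring
    nlinarith [mul_nonneg (mul_nonneg hK hK) (sub_nonneg.2 hneg), mul_nonneg (mul_nonneg hK hH0) hWpos.le]
  nlinarith [hmain]

end Summit.PneNP.PneNP.Theorems.PstarUniformRepeats
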